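import Summits.CriticalPhenomena.CardyFormulaZ2.Theorems.CardyFlipRussoQuadrupoleSelectionRuleDefs
import Summits.CriticalPhenomena.CardyFormulaZ2.Theorems.CardyFlipRussoQuadrupoleSelectionRuleRussoInequality
import Summits.CriticalPhenomena.CardyFormulaZ2.Theorems.CardyFlipRussoQuadrupoleSelectionRuleBitsLegTransfer

/-!
# The kernel WITH A RATE on the bits leg: `PairRate θ → ArmBudget θ → QuadrupoleSelectionRuleBits`,
# and its consumption along the whole leg

Helper file for the informal kernel crux `QuadrupoleSelectionRule` (stmt-CriticalPhenomena-7029) of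
route `CardyFlipRusso` (sub-problem `CardyFormulaZ2`), line `Sketch`, generation 4 (lead c2).
Vocabulary: `Theorems/CardyFlipRussoQuadrupoleSelectionRuleDefs.lean` (namespace `…Theorems.BitsLeg`).

* `abs_faceResponse_le_armWeight` — the per-face annealed Russo inequality `|E_t[Δ_k]| ≤ E_t[P(created)
  + P(destroyed)]` (no measurability needed: outer-measure subadditivity).
* `abs_pair_le_cutoff` — under the pair rate, every quarter-turn pair obeys
  `|e_h + e_v| ≤ max 1 (C C₀^{-θ}) · cutoff · (w_h + w_v)`: in the boundary layer by the Russo inequality,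
  beyond it by the rate.
* `bits_of_pairRate_armBudget` — **the reduction**: summing the pair bounds against the arm budget
  gives the kernel on L5 in its consumed form `QuadrupoleSelectionRuleBits`.
* `legProb_uniform_close_of_bits` — **the consumption**: the kernel in consumed form gives uniform
  closeness of the annealed crude crossing probabilities `legProb R · δ` on the whole leg `[0,1]` for
  small mesh (landed annealed flip–Russo formula + mean-value step,
  `uniform_close_annealed_flipLeg_of_kernel_bound`), hence Cardy at `t = 1` (`G_s`) from Cardy at
  `t = ½` by an `ε/2` argument.

So on the bits leg the open content of the kernel is exactly `∃ θ, PairRate θ ∧ ArmBudget θ`: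
PairRate is the selection rule proper (MC-tested on L5 by the lead, kit job attached to the item),
ArmBudget the a-priori arm estimate uniform along the leg.
-/

noncomputable section

open MeasureTheory Filter Topology Set
open scoped BigOperators

namespace Summit.CriticalPhenomena.CardyFormulaZ2.Theorems.BitsLeg

open Literature.Probability.LatticeModels Literature.Probability.Percolation
  Literature.Probability.RandomPlanarGeometry

/-! ### The per-face Russo inequality -/

/-- Measurability-free form of `|P(U') − P(U)| ≤ P(U' ∖ U) + P(U ∖ U')` for a finite measure
(outer-measure monotonicity and subadditivity). -/
theorem abs_real_sub_real_le {Ω : Type*} [MeasurableSpace Ω] (μ : Measure Ω) [IsFiniteMeasure μ]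
    (U U' : Set Ω) : |μ.real U' - μ.real U| ≤ μ.real (U' \ U) + μ.real (U \ U') := by
  have h1 : μ.real U' ≤ μ.real U + μ.real (U' \ U) := by
    calc μ.real U' ≤ μ.real (U ∪ (U' \ U)) := measureReal_mono (by
            intro ω hω; by_cases h : ω ∈ U
            · exact Or.inl h
            · exact Or.inr ⟨hω, h⟩)
      _ ≤ μ.real U + μ.real (U' \ U) := measureReal_union_le _ _
  have h2 : μ.real U ≤ μ.real U' + μ.real (U \ U') := by
    calc μ.real U ≤ μ.real (U' ∪ (U \ U')) := measureReal_mono (by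
            intro ω hω; by_cases h : ω ∈ U'
            · exact Or.inl h
            · exact Or.inr ⟨hω, h⟩)
      _ ≤ μ.real U' + μ.real (U \ U') := measureReal_union_le _ _
  rw [abs_sub_le_iff]
  constructor <;> nlinarith [measureReal_nonneg (μ := μ) (s := U' \ U),
    measureReal_nonneg (μ := μ) (s := U \ U')]

/-- Pointwise in the environment: `|Δ_k| ≤ P(created) + P(destroyed)`, with no measurability
hypothesis on the event (compare `abs_flipResponse_le_real_sdiff_add`). -/
theorem abs_flipResponse_le_sdiff_add {W : Type*} (G : SimpleGraph W) (A B C D : W)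
    (U : SimpleGraph W → Set (SiteConfig W)) (p : unitInterval) :
    |flipResponse G A B C D U p| ≤
      (sitePercolation W p).real (U (flipGraph G A B C D) \ U G) +
        (sitePercolation W p).real (U G \ U (flipGraph G A B C D)) := by
  rw [flipResponse_def]
  exact abs_real_sub_real_le (sitePercolation W p) (U G) (U (flipGraph G A B C D))

/-- **Per-face annealed Russo inequality**: `|E_t[Δ_k]| ≤ E_t[P(created) + P(destroyed)]`, i.e.
`|faceResponse R t δ k| ≤ armWeight R t δ k`. -/
theorem abs_faceResponse_le_armWeight (R : ConformalRectangle) (t δ : ℝ) (k : Face) :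
    |faceResponse R t δ k| ≤ armWeight R t δ k := by
  classical
  unfold faceResponse armWeight legLaw
  set f : Set Face → ℝ := fun τ => flipResponse (GammaMesh R δ (τ \ {k})) (fA k) (fB k) (fC k)
    (fD k) (crossingEvent R δ) half with hf
  set g : Set Face → ℝ := fun τ => (sitePercolation V half).real
        (crossingEvent R δ (flipGraph (GammaMesh R δ (τ \ {k})) (fA k) (fB k) (fC k) (fD k)) \
          crossingEvent R δ (GammaMesh R δ (τ \ {k}))) +
      (sitePercolation V half).real
        (crossingEvent R δ (GammaMesh R δ (τ \ {k})) \
          crossingEvent R δ (flipGraph (GammaMesh R δ (τ \ {k})) (fA k) (fB k) (fC k) (fD k)))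
    with hg
  have hfK : ∀ τ, f τ = f (τ ∩ ↑(faces R δ)) := fun τ => by
    simp only [hf, gammaMesh_sdiff_eq R δ k τ]
  have hgK : ∀ τ, g τ = g (τ ∩ ↑(faces R δ)) := fun τ => by
    simp only [hg, gammaMesh_sdiff_eq R δ k τ]
  have hfle : ∀ τ, |f τ| ≤ g τ := fun τ =>
    abs_flipResponse_le_sdiff_add _ _ _ _ _ (crossingEvent R δ) half
  have hg2 : ∀ τ, |g τ| ≤ 2 := fun τ => by
    have h0 : 0 ≤ g τ := le_trans (abs_nonneg _) (hfle τ)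
    rw [abs_of_nonneg h0]
    have h1 : (sitePercolation V half).real
        (crossingEvent R δ (flipGraph (GammaMesh R δ (τ \ {k})) (fA k) (fB k) (fC k) (fD k)) \
          crossingEvent R δ (GammaMesh R δ (τ \ {k}))) ≤ 1 := measureReal_le_one
    have h2 : (sitePercolation V half).real
        (crossingEvent R δ (GammaMesh R δ (τ \ {k})) \
          crossingEvent R δ (flipGraph (GammaMesh R δ (τ \ {k})) (fA k) (fB k) (fC k) (fD k)))
          ≤ 1 := measureReal_le_one
    simp only [hg]
    linarith
  have hfi : Integrable f (prodBernoulli fun _ : Face => Set.projIcc 0 1 zero_le_one t) :=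
    integrable_of_forall_eq_inter (faces R δ) f hfK 1
      (fun τ => abs_flipResponse_le_one _ _ _ _ _ _ _) _
  have hgi : Integrable g (prodBernoulli fun _ : Face => Set.projIcc 0 1 zero_le_one t) :=
    integrable_of_forall_eq_inter (faces R δ) g hgK 2 hg2 _
  calc |∫ τ, f τ ∂(prodBernoulli fun _ : Face => Set.projIcc 0 1 zero_le_one t)|
      ≤ ∫ τ, |f τ| ∂(prodBernoulli fun _ : Face => Set.projIcc 0 1 zero_le_one t) :=
        abs_integral_le_integral_abs
    _ ≤ ∫ τ, g τ ∂(prodBernoulli fun _ : Face => Set.projIcc 0 1 zero_le_one t) :=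
        integral_mono hfi.abs hgi hfle

/-- Four-arm weights are nonnegative. -/
theorem armWeight_nonneg (R : ConformalRectangle) (t δ : ℝ) (k : Face) :
    0 ≤ armWeight R t δ k :=
  le_trans (abs_nonneg _) (abs_faceResponse_le_armWeight R t δ k)

/-- The cut-off factor is nonnegative. -/
theorem cutoff_nonneg (C₀ θ δ d : ℝ) (hC₀ : 0 < C₀) (hδ : 0 < δ) : 0 ≤ cutoff C₀ θ δ d := by
  unfold cutoff
  split_ifs with h
  · exact zero_le_one
  · exact Real.rpow_nonneg (div_nonneg (mul_pos hC₀ hδ).le (by push Not at h; nlinarith)) _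

/-! ### The pair bound with cut-off and the reduction -/

/-- **The pair bound with cut-off.**  If every quarter-turn pair beyond the boundary layer
`depth > C₀ δ` cancels at rate `C (δ/d)^θ` against its weights, then EVERY pair satisfies
`|e_h + e_v| ≤ K · cutoff · (w_h + w_v)` with `K = max 1 (C (C₀⁻¹)^θ)`: in the boundary layer by the
per-face Russo inequality, beyond it by the rate. -/
theorem abs_pair_le_cutoff (R : ConformalRectangle) {θ C₀ C δ t : ℝ} (hC₀ : 0 < C₀) (hδ : 0 < δ)
    (hpair : ∀ x : ℤ × ℤ, C₀ * δ < depth R δ x →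
      |faceResponse R t δ (x, false) + faceResponse R t δ (x, true)| ≤
        C * (δ / depth R δ x) ^ θ * (armWeight R t δ (x, false) + armWeight R t δ (x, true)))
    (x : ℤ × ℤ) :
    |faceResponse R t δ (x, false) + faceResponse R t δ (x, true)| ≤
      max 1 (C * C₀⁻¹ ^ θ) * cutoff C₀ θ δ (depth R δ x) *
        (armWeight R t δ (x, false) + armWeight R t δ (x, true)) := by
  have hw0 := armWeight_nonneg R t δ (x, false)
  have hw1 := armWeight_nonneg R t δ (x, true)
  by_cases h : depth R δ x ≤ C₀ * δ
  · have hcut : cutoff C₀ θ δ (depth R δ x) = 1 := by simp [cutoff, h]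
    rw [hcut, mul_one]
    calc |faceResponse R t δ (x, false) + faceResponse R t δ (x, true)|
        ≤ |faceResponse R t δ (x, false)| + |faceResponse R t δ (x, true)| := abs_add_le _ _
      _ ≤ armWeight R t δ (x, false) + armWeight R t δ (x, true) :=
          add_le_add (abs_faceResponse_le_armWeight R t δ _) (abs_faceResponse_le_armWeight R t δ _)
      _ = 1 * (armWeight R t δ (x, false) + armWeight R t δ (x, true)) := (one_mul _).symm
      _ ≤ max 1 (C * C₀⁻¹ ^ θ) * (armWeight R t δ (x, false) + armWeight R t δ (x, true)) :=
          mul_le_mul_of_nonneg_right (le_max_left _ _) (add_nonneg hw0 hw1)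
  · push Not at h
    have hd : 0 < depth R δ x := lt_trans (mul_pos hC₀ hδ) h
    have hcut : cutoff C₀ θ δ (depth R δ x) = (C₀ * δ / depth R δ x) ^ θ := by
      simp [cutoff, not_le.2 h]
    have hsplit : (δ / depth R δ x) ^ θ = C₀⁻¹ ^ θ * (C₀ * δ / depth R δ x) ^ θ := by
      rw [← Real.mul_rpow (inv_nonneg.2 hC₀.le) (div_nonneg (mul_pos hC₀ hδ).le hd.le)]
      congr 1
      field_simp
    calc |faceResponse R t δ (x, false) + faceResponse R t δ (x, true)|
        ≤ C * (δ / depth R δ x) ^ θ * (armWeight R t δ (x, false) + armWeight R t δ (x, true)) :=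
          hpair x h
      _ = (C * C₀⁻¹ ^ θ) * cutoff C₀ θ δ (depth R δ x) *
            (armWeight R t δ (x, false) + armWeight R t δ (x, true)) := by
          rw [hcut, hsplit]; ring
      _ ≤ max 1 (C * C₀⁻¹ ^ θ) * cutoff C₀ θ δ (depth R δ x) *
            (armWeight R t δ (x, false) + armWeight R t δ (x, true)) := by
          apply mul_le_mul_of_nonneg_right _ (add_nonneg hw0 hw1)
          exact mul_le_mul_of_nonneg_right (le_max_right _ _)
            (cutoff_nonneg C₀ θ δ _ hC₀ hδ)

/-- **REDUCTION (the kernel with a rate on the bits leg).**  The pair rate and the arm budget at the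
same exponent `θ` give the kernel crux on L5 in its consumed form. -/
theorem bits_of_pairRate_armBudget :
    ∀ θ : ℝ, Summit.CriticalPhenomena.CardyFormulaZ2.Theorems.BitsLeg.PairRate θ →
      Summit.CriticalPhenomena.CardyFormulaZ2.Theorems.BitsLeg.ArmBudget θ →
        Summit.CriticalPhenomena.CardyFormulaZ2.Theorems.BitsLeg.QuadrupoleSelectionRuleBits := by
  intro θ hP hA R
  obtain ⟨C₀, hC₀, C, -, hpair⟩ := hP R
  obtain ⟨η, hη, hbudget⟩ := hA R C₀ hC₀
  set K : ℝ := max 1 (C * C₀⁻¹ ^ θ) with hK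
  refine ⟨fun δ => K * η δ, ?_, fun δ hδ hδ1 t ht => ?_⟩
  · simpa using hη.const_mul K
  · have hK0 : 0 ≤ K := le_trans zero_le_one (le_max_left _ _)
    unfold flipSum
    rw [sum_faces_eq_sum_pairs]
    calc |∑ x ∈ box R δ, (faceResponse R t δ (x, false) + faceResponse R t δ (x, true))|
        ≤ ∑ x ∈ box R δ, |faceResponse R t δ (x, false) + faceResponse R t δ (x, true)| :=
          Finset.abs_sum_le_sum_abs _ _
      _ ≤ ∑ x ∈ box R δ, K * cutoff C₀ θ δ (depth R δ x) *
              (armWeight R t δ (x, false) + armWeight R t δ (x, true)) :=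
          Finset.sum_le_sum fun x _ =>
            abs_pair_le_cutoff R hC₀ hδ (fun x hx => hpair δ hδ hδ1 t ht x hx) x
      _ = K * ∑ k ∈ faces R δ, cutoff C₀ θ δ (depth R δ k.1) * armWeight R t δ k := by
          rw [sum_faces_eq_sum_pairs, Finset.mul_sum]
          refine Finset.sum_congr rfl fun x _ => ?_
          ring
      _ ≤ K * η δ := mul_le_mul_of_nonneg_left (hbudget δ hδ hδ1 t ht) hK0

/-! ### Consumption along the whole leg -/

/-- **CONSUMPTION.**  The kernel on L5 in consumed form gives, for every conformal rectangle,
uniform closeness of the annealed crude crossing probabilities along the whole bits leg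
`t ∈ [0, 1]` for small mesh (landed annealed flip–Russo formula + mean-value step).  With Cardy's
formula at `t = ½` (uniform random diagonals, end of leg L4) this gives Cardy's formula at `t = 1`
(the centred square lattice `G_s`) by an `ε/2` argument. -/
theorem legProb_uniform_close_of_bits :
    Summit.CriticalPhenomena.CardyFormulaZ2.Theorems.BitsLeg.QuadrupoleSelectionRuleBits →
      ∀ R : Literature.Probability.RandomPlanarGeometry.ConformalRectangle, ∀ ε : ℝ, 0 < ε →
        ∃ δ₀ : ℝ, 0 < δ₀ ∧ ∀ δ : ℝ, 0 < δ → δ < δ₀ →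
          ∀ t ∈ Set.Icc (0 : ℝ) 1, ∀ t' ∈ Set.Icc (0 : ℝ) 1,
            |Summit.CriticalPhenomena.CardyFormulaZ2.Theorems.BitsLeg.legProb R t δ -
                Summit.CriticalPhenomena.CardyFormulaZ2.Theorems.BitsLeg.legProb R t' δ| ≤ ε := by
  classical
  intro h R
  obtain ⟨η, hη, hker⟩ := h R
  exact uniform_close_annealed_flipLeg_of_kernel_bound
    (fun δ => faces R δ) (fun δ τ => GammaMesh R δ τ) (fun δ τ => gammaMesh_inter R δ τ)
    fA fB fC fD (fun δ τ k hk => gammaMesh_insert R δ τ k hk) (fun δ => crossingEvent R δ)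
    half η hker hη

/-- **End to end on L5.**  `PairRate θ ∧ ArmBudget θ` ⟹ the annealed crude crossing probabilities
of every conformal rectangle are uniformly close along the whole bits leg for small mesh. -/
theorem legProb_uniform_close_of_pairRate_armBudget {θ : ℝ} (hP : PairRate θ) (hA : ArmBudget θ)
    (R : ConformalRectangle) :
    ∀ ε : ℝ, 0 < ε → ∃ δ₀ : ℝ, 0 < δ₀ ∧ ∀ δ : ℝ, 0 < δ → δ < δ₀ →
      ∀ t ∈ Icc (0 : ℝ) 1, ∀ t' ∈ Icc (0 : ℝ) 1, |legProb R t δ - legProb R t' δ| ≤ ε :=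
  legProb_uniform_close_of_bits (bits_of_pairRate_armBudget θ hP hA) R

end Summit.CriticalPhenomena.CardyFormulaZ2.Theorems.BitsLeg

end
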